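import Summits.ValiantsHypothesis.ValiantsHypothesis.Theorems.BarrierLeverPartitionMinorsChowIntegerCertificates
import Literature.Analysis.TotalPositivity.GeneralizedVandermonde
import Literature.Analysis.TotalPositivity.MultiplyPositiveProofs

/-!
# Route BarrierLever — Chow witnesses for partition minors (item 20172, CPM): the HANKEL ROUTE —
# coefficient recursion over a general coefficient ring, and «integer table with a positive
# exponential-sum representation ⇒ ONE product of `h + h` affine forms hits EVERY layout of height `h`»

Helper file (`--supports stmt-ValiantsHypothesis-20172`; cell valiant-natproofs, rung V4, 𝒟-side of
door (c); seat val-np-p4 gen 14).  Closes NO item.  Conventions of items 19717 / 20172 / 20195: in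
`MvPolynomial (Fin (h+h)) R`, `x_a = X (castAdd h a)`, `y_c = X (natAdd h c)`; the layout `(u, w)`
is HIT when some product of `h + h` affine forms has `det [coeff (E (u i) (w j)) ∏ ℓ] ≠ 0`.

THE MECHANISM (new).  For a SYMMETRIC design `F(x, y) = G(x + y)`, `G = Σ_m g_m s^m` any product of
`h + h` affine forms in `s` (complex coefficients allowed, e.g. conjugate pairs so that `G` is real),
the partition table is `N[U, W] = (1_U + 1_W)! · g_{1_U + 1_W}`; with `e U = Σ_{c ∈ U} 3^c` the digit
sum `1_U + 1_W ∈ {0,1,2}^h` never carries, so `N[U, W] = M(e U + e W)` for the single sequence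
`M n = m(n)! g_{m(n)}` (`m(n)` = base-`3` digits of `n < 3^h`): every partition minor of the one
witness is a minor of ONE Hankel matrix.  If `M n = Σ_k w_k t_k^n` with `≥ 2^h` positive atoms
(a Stieltjes moment sequence), all these minors are nonzero — by Cauchy–Binet and the positivity of
generalized Vandermonde determinants (tree: `det_mul_eq_sum_strictMono`, `det_pow_strictMono_pos`).

Contents (all generic in `h`; the per-height certificates live in their own files):

* `chowDPA` / `genForm` / `coeff_partitionExpo_prod_genForm` / `chowDPA_eq_of_stages` — the tree's
  integer recursion `chowDP` (`…ChowIntegerCertificates`, `…ChowCertifiedTables`) with coefficients in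
  ANY commutative ring `A` read in `R` through a ring hom `φ : A →+* R` (used with `A = ℤ[i]`,
  `φ = GaussianInt.toComplex`);
* `det_expSumKernel_pos`, `det_expSumKernel_ne_zero_of_injective` — minors of the kernel
  `Σ_k w_k t_k^{a_i + b_j}` (`0 < t` increasing, `w > 0`, exponents strictly increasing resp. injective,
  `r ≤ #atoms`) are positive resp. nonzero;
* `chow_hits_all_of_expSumTable` — **the door of the Hankel route**: if the `φ`-image of the stage-`(h+h)`
  table of some coefficient data is an INTEGER table `T`, and `Dw · D^{ea u} · D^{eb w} · T u w =
  Σ_k W_k t_k^{ea u + eb w}` for injective codes `ea, eb`, positive naturals `W_k`, strictly increasing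
  positive naturals `t_k` (`2^h ≤ #atoms`) and naturals `Dw, D`, then the `h + h` forms hit EVERY
  injective layout `(u, w)` of height `h`, of every size `r` (symmetric designs: `ea = eb = Σ_{c∈·} 3^c`;
  a general design may use any two codes with all `ea u + eb w` distinct, e.g. binary and `2^h ×` binary).

WHAT THIS IS NOT: no witness is exhibited here (that is a per-height certificate); nothing on items
20172 / 20195 / 19717 themselves (all large `h`), on crux stmt-ValiantsHypothesis-14610, or on `VP`
versus `VNP`.
-/

set_option linter.dupNamespace false

namespace Summit.ValiantsHypothesis.ValiantsHypothesis.Theorems.BarrierLever.ChowHankel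

open Finset MvPolynomial Matrix
open Summit.ValiantsHypothesis.ValiantsHypothesis.Theorems.BarrierLever.ChowFactor
  (coeff_partitionExpo_mul_affine coeff_partitionExpo_one)
open Literature.Analysis.TotalPositivity (det_pow_strictMono_pos det_mul_eq_sum_strictMono)

variable {h : ℕ}

/-! ## 1. The coefficient recursion over a general coefficient ring -/

/-- **Partition coefficients of a product of affine forms with coefficients in `A`, by recursion on
the number of forms** (the tree's `chowDP` with `ℤ` replaced by any commutative ring `A`):
`chowDPA c₀ α β m u w` is the coefficient of `x^u y^w` in `∏_{k<m} (c₀ k + Σ_a α k a·x_a + Σ_c β k c·y_c)`. -/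
def chowDPA {A : Type*} [CommRing A] (c₀ : ℕ → A) (α β : ℕ → Fin h → A) :
    ℕ → Finset (Fin h) → Finset (Fin h) → A
  | 0, u, w => if u = ∅ ∧ w = ∅ then 1 else 0
  | m + 1, u, w => c₀ m * chowDPA c₀ α β m u w +
      (∑ a ∈ u, α m a * chowDPA c₀ α β m (u.erase a) w) +
      ∑ c ∈ w, β m c * chowDPA c₀ α β m u (w.erase c)

/-- The `k`-th affine form `φ(c₀ k) + Σ_a φ(α k a) · x_a + Σ_c φ(β k c) · y_c`, its coefficients read in
`R` through the ring hom `φ : A →+* R`. -/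
noncomputable def genForm {A R : Type*} [CommRing A] [CommRing R] (φ : A →+* R) (c₀ : ℕ → A)
    (α β : ℕ → Fin h → A) (k : ℕ) : MvPolynomial (Fin (h + h)) R :=
  C (φ (c₀ k)) + ∑ a, C (φ (α k a)) * X (Fin.castAdd h a) + ∑ c, C (φ (β k c)) * X (Fin.natAdd h c)

/-- A `genForm` has total degree `≤ 1`. -/
theorem totalDegree_genForm_le {A R : Type*} [CommRing A] [CommRing R] (φ : A →+* R) (c₀ : ℕ → A)
    (α β : ℕ → Fin h → A) (k : ℕ) : (genForm φ c₀ α β k).totalDegree ≤ 1 := by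
  have hterm : ∀ (r : R) (v : Fin (h + h)), (C r * X v : MvPolynomial (Fin (h + h)) R).totalDegree ≤ 1 :=
    fun r v => by
      refine (totalDegree_mul _ _).trans ?_
      rw [totalDegree_C, zero_add]
      refine (totalDegree_monomial_le _ _).trans ?_
      rw [Finsupp.sum_single_index rfl]
      exact le_rfl
  unfold genForm
  refine (totalDegree_add _ _).trans (max_le ((totalDegree_add _ _).trans (max_le ?_ ?_)) ?_)
  · rw [totalDegree_C]
    exact Nat.zero_le _
  · exact (totalDegree_finsetSum _ _).trans (Finset.sup_le fun a _ => hterm _ _)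
  · exact (totalDegree_finsetSum _ _).trans (Finset.sup_le fun c _ => hterm _ _)

/-- **The recursion is the coefficient** (general coefficient ring): the partition coefficient at
`(u, w)` of the product of the first `m` forms `genForm φ c₀ α β k` is `φ (chowDPA c₀ α β m u w)`. -/
theorem coeff_partitionExpo_prod_genForm {A R : Type*} [CommRing A] [CommRing R] (φ : A →+* R)
    (c₀ : ℕ → A) (α β : ℕ → Fin h → A) (m : ℕ) : ∀ u w : Finset (Fin h),
    coeff (∑ a ∈ u, Finsupp.single (Fin.castAdd h a) 1 + ∑ c ∈ w, Finsupp.single (Fin.natAdd h c) 1)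
      (∏ k ∈ Finset.range m, genForm φ c₀ α β k) = φ (chowDPA c₀ α β m u w) := by
  classical
  induction m with
  | zero =>
    intro u w
    rw [Finset.prod_range_zero, coeff_partitionExpo_one, chowDPA]
    split_ifs <;> simp
  | succ m ih =>
    intro u w
    rw [Finset.prod_range_succ, genForm, coeff_partitionExpo_mul_affine, ih, chowDPA]
    simp_rw [ih]
    simp only [map_add, map_mul, map_sum]

/-- **Certified recursion** (general coefficient ring): any sequence of tables `S m` satisfying the
base case and the one-step recursion of `chowDPA` below stage `M` IS `chowDPA` up to stage `M`. -/
theorem chowDPA_eq_of_stages {A : Type*} [CommRing A] (c₀ : ℕ → A) (α β : ℕ → Fin h → A)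
    (S : ℕ → Finset (Fin h) → Finset (Fin h) → A) (M : ℕ)
    (hbase : ∀ u w : Finset (Fin h), S 0 u w = if u = ∅ ∧ w = ∅ then 1 else 0)
    (hstep : ∀ m, m < M → ∀ u w : Finset (Fin h), S (m + 1) u w =
      c₀ m * S m u w + (∑ a ∈ u, α m a * S m (u.erase a) w) + ∑ c ∈ w, β m c * S m u (w.erase c)) :
    ∀ m, m ≤ M → ∀ u w : Finset (Fin h), S m u w = chowDPA c₀ α β m u w := by
  intro m
  induction m with
  | zero =>
    intro _ u w
    rw [hbase, chowDPA]
  | succ m ih =>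
    intro hm u w
    rw [hstep m (by omega), chowDPA, ih (by omega) u w]
    simp only [ih (by omega)]

/-! ## 2. Exponential-sum (Stieltjes–Hankel) kernels: sorted minors are positive -/

/-- **Exponential-sum kernel minors are positive.**  For nodes `0 < t₀ < ⋯ < t_{R-1}`, weights
`w_k > 0`, and strictly increasing exponents `a, b : Fin r → ℕ` (`r ≤ R`),
`0 < det [Σ_k w_k · t_k ^ (a i + b j)]`: the matrix is `A · B` with `A i k = w_k t_k^{a_i}`,
`B k j = t_k^{b_j}`; by Cauchy–Binet every term is `(∏ w) ·` (two generalized Vandermonde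
determinants), all positive, and the term at `Fin.castLE` exists. -/
theorem det_expSumKernel_pos {r R : ℕ} (t w : Fin R → ℝ) (ht0 : ∀ k, 0 < t k) (ht : StrictMono t)
    (hw : ∀ k, 0 < w k) (a b : Fin r → ℕ) (ha : StrictMono a) (hb : StrictMono b) (hrR : r ≤ R) :
    0 < (Matrix.of fun i j : Fin r => ∑ k, w k * t k ^ (a i + b j)).det := by
  classical
  set A : Matrix (Fin r) (Fin R) ℝ := Matrix.of fun i k => w k * t k ^ a i with hAdef
  set B : Matrix (Fin R) (Fin r) ℝ := Matrix.of fun k j => t k ^ b j with hBdef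
  have hAB : (Matrix.of fun i j : Fin r => ∑ k, w k * t k ^ (a i + b j)) = A * B := by
    ext i j
    simp only [hAdef, hBdef, Matrix.mul_apply, Matrix.of_apply, pow_add, mul_assoc]
  rw [hAB, det_mul_eq_sum_strictMono]
  apply Finset.sum_pos
  · intro τ hτ
    have hτm : StrictMono τ := (Finset.mem_filter.mp hτ).2
    have hAeq : A.submatrix id τ =
        (Matrix.of fun i k : Fin r => t (τ k) ^ a i) * Matrix.diagonal (fun k => w (τ k)) := by
      ext i k
      simp only [hAdef, Matrix.submatrix_apply, id, Matrix.of_apply, Matrix.mul_diagonal, mul_comm]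
    have hGVa : 0 < (Matrix.of fun i k : Fin r => t (τ k) ^ a i).det := by
      rw [← Matrix.det_transpose]
      have htr : (Matrix.of fun i k : Fin r => t (τ k) ^ a i).transpose =
          Matrix.of fun k i : Fin r => t (τ k) ^ a i := by
        ext k i
        simp only [Matrix.transpose_apply, Matrix.of_apply]
      rw [htr]
      exact det_pow_strictMono_pos _ _ (fun k => ht0 _) (ht.comp hτm) ha
    have hGVb : 0 < (B.submatrix τ id).det := by
      have hBeq : B.submatrix τ id = Matrix.of fun k j : Fin r => t (τ k) ^ b j := by
        ext k j
        simp only [hBdef, Matrix.submatrix_apply, id, Matrix.of_apply]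
      rw [hBeq]
      exact det_pow_strictMono_pos _ _ (fun k => ht0 _) (ht.comp hτm) hb
    rw [hAeq, Matrix.det_mul, Matrix.det_diagonal]
    exact mul_pos (mul_pos hGVa (Finset.prod_pos fun k _ => hw _)) hGVb
  · refine ⟨Fin.castLE hrR, Finset.mem_filter.mpr ⟨Finset.mem_univ _, fun i j hij => ?_⟩⟩
    exact hij

/-- **Injective exponents suffice**: for nodes `0 < t₀ < ⋯ < t_{R-1}`, weights `w_k > 0` and INJECTIVE
exponent families `a, b : Fin r → ℕ` with `r ≤ R`, `det [Σ_k w_k · t_k ^ (a i + b j)] ≠ 0` (sort rows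
and columns with `Tuple.sort`; the sorted minor is positive by `det_expSumKernel_pos`). -/
theorem det_expSumKernel_ne_zero_of_injective {r R : ℕ} (t w : Fin R → ℝ) (ht0 : ∀ k, 0 < t k)
    (ht : StrictMono t) (hw : ∀ k, 0 < w k) (a b : Fin r → ℕ) (ha : Function.Injective a)
    (hb : Function.Injective b) (hrR : r ≤ R) :
    (Matrix.of fun i j : Fin r => ∑ k, w k * t k ^ (a i + b j)).det ≠ 0 := by
  classical
  set σ : Equiv.Perm (Fin r) := Tuple.sort a with hσ
  set ρ : Equiv.Perm (Fin r) := Tuple.sort b with hρ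
  have hσm : StrictMono (a ∘ σ) := (Tuple.monotone_sort a).strictMono_of_injective (ha.comp σ.injective)
  have hρm : StrictMono (b ∘ ρ) := (Tuple.monotone_sort b).strictMono_of_injective (hb.comp ρ.injective)
  have hpos := det_expSumKernel_pos t w ht0 ht hw (a ∘ σ) (b ∘ ρ) hσm hρm hrR
  have hsub : (Matrix.of fun i j : Fin r => ∑ k, w k * t k ^ ((a ∘ σ) i + (b ∘ ρ) j)) =
      (Matrix.of fun i j : Fin r => ∑ k, w k * t k ^ (a i + b j)).submatrix σ ρ := by
    ext i j
    simp only [Matrix.submatrix_apply, Matrix.of_apply, Function.comp]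
  intro hzero
  rw [hsub] at hpos
  have habs := Matrix.abs_det_submatrix_equiv_equiv σ ρ
    (Matrix.of fun i j : Fin r => ∑ k, w k * t k ^ (a i + b j))
  rw [hzero, abs_zero] at habs
  exact hpos.ne' (abs_eq_zero.mp habs)

/-! ## 3. The door: an integer table with a positive exponential-sum representation hits everything -/

/-- Injective families of subsets of `Fin h` have at most `2^h` members. -/
theorem card_le_two_pow_of_injective {r : ℕ} (u : Fin r → Finset (Fin h)) (hu : Function.Injective u) :
    r ≤ 2 ^ h := by
  have := Fintype.card_le_of_injective u hu
  simpa [Fintype.card_fin, Fintype.card_finset] using this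

/-- **The door of the Hankel route.**  Data: coefficients `c₀, α, β` in a commutative ring `A` read in
`ℂ` through an injective-on-`ℤ`-compatible hom `φ` (any ring hom will do: we only use that `φ` agrees
with the integer cast on the table), an INTEGER table `T` with `φ (chowDPA c₀ α β (h+h) u w) = T u w`,
injective codes `ea, eb : Finset (Fin h) → ℕ` (row / column exponents), atoms `t_k` (strictly
increasing positive naturals, at least `2^h` of them), positive natural weights `W_k`, and naturals
`Dw, D` (denominator clearing) with the exact identity
`Σ_k W_k t_k^{ea u + eb w} = Dw · D^{ea u} · D^{eb w} · T u w` for all `u, w`.  Conclusion: the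
`h + h` affine forms `genForm φ c₀ α β k` hit EVERY injective layout of height `h`. -/
theorem chow_hits_all_of_expSumTable {A : Type*} [CommRing A] (φ : A →+* ℂ) (c₀ : ℕ → A)
    (α β : ℕ → Fin h → A) (T : Finset (Fin h) → Finset (Fin h) → ℤ)
    (hT : ∀ u w, φ (chowDPA c₀ α β (h + h) u w) = (T u w : ℂ))
    (ea eb : Finset (Fin h) → ℕ) (hea : Function.Injective ea) (heb : Function.Injective eb)
    {R : ℕ} (hR : 2 ^ h ≤ R) (t W : Fin R → ℕ) (ht0 : ∀ k, 0 < t k) (ht : StrictMono t)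
    (hW : ∀ k, 0 < W k) (Dw D : ℕ)
    (hcert : ∀ u w, (∑ k, W k * t k ^ (ea u + eb w) : ℤ) = Dw * D ^ ea u * D ^ eb w * T u w)
    {r : ℕ} (u w : Fin r → Finset (Fin h)) (hu : Function.Injective u) (hw : Function.Injective w) :
    ∃ ℓ : Fin (h + h) → MvPolynomial (Fin (h + h)) ℂ, (∀ q, (ℓ q).totalDegree ≤ 1) ∧
      (Matrix.of fun i j : Fin r => coeff
        (∑ b ∈ u i, Finsupp.single (Fin.castAdd h b) 1 + ∑ d ∈ w j, Finsupp.single (Fin.natAdd h d) 1)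
        (∏ q, ℓ q)).det ≠ 0 := by
  classical
  -- the integer partition matrix and its determinant
  set M : Matrix (Fin r) (Fin r) ℤ := Matrix.of fun i j => T (u i) (w j) with hM
  have hrR : r ≤ R := (card_le_two_pow_of_injective u hu).trans hR
  -- the certificate matrix over ℝ
  have hker : (Matrix.of fun i j : Fin r =>
      ∑ k, (W k : ℝ) * (t k : ℝ) ^ ((ea ∘ u) i + (eb ∘ w) j)).det ≠ 0 :=
    det_expSumKernel_ne_zero_of_injective (fun k => (t k : ℝ)) (fun k => (W k : ℝ))
      (fun k => by exact_mod_cast ht0 k) (fun i j hij => by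
        show (t i : ℝ) < (t j : ℝ)
        exact_mod_cast ht hij)
      (fun k => by exact_mod_cast hW k) (ea ∘ u) (eb ∘ w) (hea.comp hu) (heb.comp hw) hrR
  have hkerZ : (Matrix.of fun i j : Fin r => (∑ k, W k * t k ^ (ea (u i) + eb (w j)) : ℤ)).det ≠ 0 := by
    intro h0
    apply hker
    have e1 : (Matrix.of fun i j : Fin r => ∑ k, (W k : ℝ) * (t k : ℝ) ^ ((ea ∘ u) i + (eb ∘ w) j)) =
        (Int.castRingHom ℝ).mapMatrix
          (Matrix.of fun i j : Fin r => (∑ k, W k * t k ^ (ea (u i) + eb (w j)) : ℤ)) := by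
      ext i j
      simp only [Matrix.of_apply, RingHom.mapMatrix_apply, Matrix.map_apply, Function.comp,
        map_sum, map_mul, map_pow, map_natCast]
    rw [e1, ← RingHom.map_det, h0, map_zero]
  -- the certificate matrix is `Dw •` (diagonal · M · diagonal)
  have hfac : (Matrix.of fun i j : Fin r => (∑ k, W k * t k ^ (ea (u i) + eb (w j)) : ℤ)) =
      Matrix.diagonal (fun i => (Dw : ℤ) * D ^ ea (u i)) * M * Matrix.diagonal (fun j => (D : ℤ) ^ eb (w j)) := by
    ext i j
    rw [Matrix.of_apply, hcert, Matrix.mul_apply]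
    simp only [Matrix.diagonal_mul, Matrix.diagonal_apply, hM, Matrix.of_apply, mul_ite, mul_zero,
      Finset.sum_ite_eq', Finset.mem_univ, if_true]
    ring
  have hdetZ : M.det ≠ 0 := by
    intro h0
    apply hkerZ
    rw [hfac, Matrix.det_mul, Matrix.det_mul, h0, mul_zero, zero_mul]
  -- the witness
  refine ⟨fun q => genForm φ c₀ α β (q : ℕ), fun q => totalDegree_genForm_le φ c₀ α β (q : ℕ), ?_⟩
  have hprod : (∏ q : Fin (h + h), genForm φ c₀ α β (q : ℕ)) =
      ∏ k ∈ Finset.range (h + h), genForm φ c₀ α β k :=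
    Fin.prod_univ_eq_prod_range (fun k => genForm φ c₀ α β k) (h + h)
  have hmat : (Matrix.of fun i j : Fin r => coeff
      (∑ b ∈ u i, Finsupp.single (Fin.castAdd h b) 1 + ∑ d ∈ w j, Finsupp.single (Fin.natAdd h d) 1)
      (∏ q : Fin (h + h), genForm φ c₀ α β (q : ℕ))) = (Int.castRingHom ℂ).mapMatrix M := by
    ext i j
    rw [Matrix.of_apply, hprod, coeff_partitionExpo_prod_genForm, hT, RingHom.mapMatrix_apply,
      Matrix.map_apply, hM, Matrix.of_apply]
    rfl
  rw [hmat, ← RingHom.map_det]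
  exact (map_ne_zero_iff _ (RingHom.injective_int _)).mpr hdetZ

end Summit.ValiantsHypothesis.ValiantsHypothesis.Theorems.BarrierLever.ChowHankel
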